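import Summits.ValiantsHypothesis.ValiantsHypothesis.Theses.LacunarySymmetroid
import Summits.ValiantsHypothesis.ValiantsHypothesis.Theorems.MatrixDescartes.Negative.MatrixDescartesSymmetryFree
-- The two sibling files below are LANDED (p148426, p148430) and belong to this file's findings; they are cited by
-- name in §A/§C and not imported only because the farm had no olean for them when this version was published:
-- import Summits.ValiantsHypothesis.ValiantsHypothesis.Theorems.MatrixDescartes.Negative.MatrixDescartesLoadBearing
-- import Summits.ValiantsHypothesis.ValiantsHypothesis.Theorems.MatrixDescartes.Negative.MatrixDescartesWitness24

/-!
# Disproof of `MatrixDescartes` (crux stmt-ValiantsHypothesis-18050, route LacunarySymmetroid) — findings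

Seat `refuter-cdisprove-stmt-ValiantsHypothesis-18050-0`, cycle 1 (2026-08-17).  Crux (MDR):
`∀ c q, 0 < q → ∃ K₀, ∀ K m, K₀ ≤ K → m ≤ 2^((⌊log₂K⌋+c)^c) → ∀ d S (real symmetric m×m),
 Z^q ≤ 2^(K⌊log₂K⌋)`, `Z = #`distinct real zeros of `det (∑ₗ X^{dₗ} Sₗ)` — i.e. `log Z = o(K log K)`
for lacunary symmetric pencils of quasi-polynomial size.  Line picked by the lead: `Lift`
(`Lines/Lift.lean`, C⁺ = `OneIndefiniteDescartes` ≅ crux).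

**VERDICT (cycle 1): NO KILL.**  The statement elaborates (rc 0), has no junk instance (the `∃ K₀`
absorbs `K ≤ 1`, `Nat.log 2 0 = Nat.log 2 1 = 0`, `roots 0 = ∅`, `c = 0 ⇒ m ≤ 2`), and every cheap
refutation mechanism is either provably too weak INSIDE the regime or reduces to an open problem of at
least the same grade (§D).  What is certified instead (all sorry-free, FIVE files LANDED under
`Theorems/MatrixDescartes/Negative/`: p148426 `…LoadBearing` @48b01254fd83, p148518 `…SymmetryFree`
@dc9456e7e6c5, p148430 `…Witness24` @a1753f456ae4, p150934 `…OneIndefiniteLoadBearing` @db5c560457f3,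
p150097 `…OneIndefiniteIff` @77c686a002fa; namespace
`Summit.ValiantsHypothesis.ValiantsHypothesis.Theorems.MatrixDescartes.Negative`, opened below):

## Index
* §A  LOAD-BEARING ANALYSIS (`…LoadBearing`, p148426).  One witness — the diagonal pencil
  `X•I − diag(1,…,m)` padded with zero terms, `Z = m` exactly (`card_roots_SW`) — shows:
  `matrixDescartes_false_without_sizeBound` (drop `m ≤ 2^((L+c)^c)` ⇒ false),
  `matrixDescartes_false_without_eventually` (`∀ K ≥ 2` instead of `∃ K₀` ⇒ false at `c=2,q=1,K=2,m=5`),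
  `matrixDescartes_false_uniform_in_c` / `_in_q` (`K₀` must depend on `c` AND on `q`: the prefix
  `∀ c q ∃ K₀` does not commute), `matrixDescartes_iff_forall_q` (`0 < q` is decoration),
  `exists_symm_pencil_card_roots_eq` (tightness floor: `Z = m = 2^((L+c)^c)` is attained in-regime, so
  `log₂ Z` reaches `(log₂K + c)^c` for every `c` — nothing below quasi-polynomial can replace the bound,
  and any proof must spend the size hypothesis).
* §B  SYMMETRY IS FREE (`…SymmetryFree`, p148518): `matrixDescartes_iff_general : MDR ↔ MDR for
  ARBITRARY real square coefficients` by the doubling `[[0,P],[Pᵀ,1]]` (`det = (−1)^m det P²`, same zero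
  set, size `2m`, `K+1` terms, `(c,q) ↦ (c+1,2q)`).  So provers get no leverage from self-adjointness per
  se, and disprovers may search general/Hessenberg/ABP pencils (every ABP over lacunary monomials
  `c·X^{d}` is such a determinant: `det_hessDet = pathSum`, tree
  `Theorems/DerivedPencilRolle/Negative/DerivedPencilRolleHessenbergPathSum.lean`).  MDR is therefore
  exactly "real-τ for algebraic branching programs over `K` lacunary monomials at size `2^{polylog K}`,
  rate `o(K log K)`".
* §C  SMALL MODEL (`…Witness24`, p148430): the lead's `(m,K) = (2,4)` symmetric witness is
  kernel-certified, `Z₊ ≥ 9 = C(5,3) − 1` (Descartes-EXTREMAL): the natural "law" strengthenings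
  (`DimensionLaw` `K·m(m+1)/2 − m² = 8`, `QuadricRung 3`, the definite-pencil rule `m(K−1) = 6` of
  Cameron–Psarrakos Thm 3) are false (`not_dimensionLaw_two_four`, `not_definiteRule_two_four`).
  Together with the strategist's paper facts (3-term symmetric pencils Descartes-sharp for all `m`;
  Carstensen bumps `log₂Z ≈ log₂²(m+K)`) this says: NO parameter-count / polynomial law is the mechanism;
  the first statement not refuted is quasi-polynomial (`MatrixDescartesQP`, StrategySketch.lean).
* §D  WHY IT RESISTS — the negation map, mechanism by mechanism (prose block below; numbers, not
  adjectives).  Bottom line: an MDR-monster must be super-quasi-polynomial in `m` in EVERY regime `c`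
  (`Z ≥ 2^{K log K/q}` with `K ≥ 2^{(log m)^{1/c}}`), hence (i) tropical/dominance monsters need
  `2^{Ω(K log K)}` optimal permutations of a parametric ASSIGNMENT on `poly(m,K)` nodes — a positive
  answer to Hrubeš–Yehudayoff 2021 Open Problem 1 (super-quasi-polynomial Birkhoff shadows; sibling crux
  `DivisionGap.ShadowBirkhoff` stmt-5069, open, register-face lines dead); (ii) path/ABP dominance
  (Carstensen–Mulmuley–Shah bumps, the sibling 18500 refutation) is capped by Gusfield at
  `2^{O(log²(mK))} = 2^{polylog K} ≪ 2^{K log K/q}` for every `c`; (iii) products / Kronecker sums /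
  compositions / cloning are additive in the format (`Z ≤ poly(m)·K`); (iv) interpolation
  (Descartes-sharpness) is parameter-capped beyond `m = 2,3` small `K`; (v) cancellation-driven theta
  profiles ARE the summit's negation (`VNP`-family with a `2^{polylog}` determinant).  No mechanism (vi).
* §E  LINE `Lift` — stub audit: the four delegated stubs `stub_psdDominate`, `stub_psdBlocks`,
  `stub_liftDet`, `stub_arith` are TRUE (vetted on paper here; meanwhile all four LANDED by provers,
  p147024 / p147006 / p148960 / p147140, and `Lines/Lift.lean` discharges them by the tree theorems);
  glue `MatrixDescartes_of_oneIndefinite` kernel-checked; the one remaining sorry `stub_oneIndefinite`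
  ≅ crux, NOW CERTIFIED BOTH WAYS: C⁺ ⇒ MDR = the glue, MDR ⇒ C⁺ =
  `oneIndefiniteDescartes_of_matrixDescartes` (p150097, `Fintype.equivFin` transport, `(c,q) ↦ (c,2q)`) — the
  line is a normal form with zero slack; and C⁺'s own `K₀` / size bound are load-bearing
  (`oneIndefinite_false_without_eventually`, `oneIndefinite_false_without_sizeBound`, p150934: at
  `card κ = 1` the bound reads `Z ≤ 1` while `J = −diag(1..5)`, `P = I` give `Z = 5`).  Degenerate probe of C⁺: `card κ = 1` would force `Z ≤ 1` and is FALSE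
  (`det(−I + X·diag(1,½,…,1/n))` has `n` zeros) — harmless only because `∃ K₀` excludes it; a lead who
  ever fixes `K₀` small must remember this.  No stub is false; nothing to post as `stub-false`.
* §F  TARGETS: none this cycle (payload `stuck_stubs = []`).
-/

-- `Summit.ValiantsHypothesis.ValiantsHypothesis.…` repeats a component by the D-0017 layout
-- (single-conjunct summit), which the `dupNamespace` linter flags; the name is mandated.
set_option linter.dupNamespace false

namespace Summit.ValiantsHypothesis.ValiantsHypothesis.Cruxes.MatrixDescartes.Disproof

open Summit.ValiantsHypothesis.ValiantsHypothesis.Theses.LacunarySymmetroid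
open Summit.ValiantsHypothesis.ValiantsHypothesis.Theorems.MatrixDescartes.Negative
open scoped BigOperators Matrix
open Polynomial

/-! ## §A–§C  Landed negative lemmas (all in the tree; §B imported, §A/§C cited by name)

* §A `MatrixDescartesWithoutSizeBound`, `matrixDescartes_false_without_sizeBound`;
  `MatrixDescartesWithoutEventually`, `matrixDescartes_false_without_eventually`;
  `MatrixDescartesUniformInC`, `matrixDescartes_false_uniform_in_c`;
  `MatrixDescartesUniformInQ`, `matrixDescartes_false_uniform_in_q`;
  `matrixDescartes_iff_forall_q`; `exists_symm_pencil_card_roots_eq` (witness `dW`, `SW`, `card_roots_SW`).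
* §B `MatrixDescartesGeneral`, `matrixDescartesGeneral_of_matrixDescartes`,
  `matrixDescartes_of_matrixDescartesGeneral`, `matrixDescartes_iff_general` (doubling `dD`, `BD`, `SD`,
  `det_pencil_SD : det = C((−1)^m) · (det P)²`, `card_roots_SD`).
* §C `S₂₄`, `d₂₄`, `nine_le_card_posRoots_F₂₄`, `PosRootLawAt`, `not_dimensionLaw_two_four`,
  `not_definiteRule_two_four`, `descartes_extremal_two_four`.
* §E `OneIndefiniteDescartes` (verbatim C⁺), `oneIndefiniteDescartes_of_matrixDescartes` (`…OneIndefiniteIff`);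
  `OneIndefiniteDescartesWithoutEventually`, `oneIndefinite_false_without_eventually`,
  `OneIndefiniteDescartesWithoutSizeBound`, `oneIndefinite_false_without_sizeBound` (`…OneIndefiniteLoadBearing`).
-/

/-- Sanity composition: MDR is equivalent to its symmetry-free, `q`-unguarded form (§B's
`matrixDescartes_iff_general` plus the `q = 0` triviality of §A's `matrixDescartes_iff_forall_q`). -/
theorem matrixDescartes_iff_general_forall_q :
    MatrixDescartes ↔
      ∀ c q : ℕ, ∃ K₀ : ℕ, ∀ K m : ℕ, K₀ ≤ K → m ≤ 2 ^ ((Nat.log 2 K + c) ^ c) →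
        ∀ (d : Fin K → ℕ) (T : Fin K → Matrix (Fin m) (Fin m) ℝ),
          (Matrix.det (∑ l, ((Polynomial.X : Polynomial ℝ) ^ d l) • (T l).map Polynomial.C)
            ).roots.toFinset.card ^ q ≤ 2 ^ (K * Nat.log 2 K) := by
  rw [matrixDescartes_iff_general]
  constructor
  · intro h c q
    rcases Nat.eq_zero_or_pos q with hq | hq
    · subst hq
      exact ⟨0, fun K m _ _ d T => by rw [pow_zero]; exact Nat.one_le_two_pow⟩
    · exact h c q hq
  · intro h c q _
    exact h c q

/-! ## §D  Why it resists — the negation map (cycle 1)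

A counterexample is a family with `Z ≥ 2^{εK log K}` at `m ≤ 2^{(L+c)^c}` for ONE fixed `(c, ε)` and
infinitely many `K` (`L = ⌊log₂K⌋`).  Equivalently in the size variable: `K ≥ 2^{(log₂m)^{1/c}} − c`, so
`Z` must be super-quasi-polynomial in `m` whatever `c` is (`2^{(log m)^{1/c}} ≫ (log m)^A` eventually).

1. PRODUCTS / BLOCK SUMS / KRONECKER SUMS / COMPOSITION `p(q(X))` / RESULTANTS: `Z ≤ (#blocks)·(zeros per
   block)`, `Z(A ⊕ (−B)) ≤ #{λᵢ(A) = μⱼ(B)}` = a resultant of characteristic polynomials, `p∘q` via the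
   companion pencil `q(X)•I − C_p`: all give `Z = O(m·K)` — additive in the format (`log Z ≤ (L+c)^c +
   log K`).  §A's diagonal witness is the extremal member (`Z = m`).
2. INTERPOLATION (Descartes-sharp symmetroids): parameters `K·m(m+1)/2` vs monomials `C(m+K−1,K−1)`; the
   coefficient map stops being dominant at `(2,5)/(3,4)`; sharpness is certified at `(2,3)`, `(2,4)` (§C),
   `(m,3)` all `m` (Vinnikov, strategist N2) — polynomial counts, harmless.
3. TROPICAL / PATCHWORKED MONSTERS: with `Sₗ = (±t^{v_{ijl}})`, `t → 0`, positive zeros = sign alternations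
   along the lower hull of `{(Σᵢ d_{λ(i)}, Σᵢ v_{iσ(i)λ(i)})}` = breakpoints of the parametric ASSIGNMENT
   with entry costs `min_l (v_{ijl} + θ d_l)`.  Each `(σ,λ)` line appears once on the concave envelope and
   each `σ` contributes `≤ m(K−1)+1` pieces, so `#breakpoints ≤ (#optimal σ)·(mK)`; splitting parallel
   edges (`i – a – b – j` gadgets) embeds the instance into a LINEAR parametric assignment on `O(m²K)`
   nodes.  Hence a tropical MDR-monster needs `2^{Ω(K log K)}/(mK)` optimal permutations on `poly(m,K)`
   nodes = super-quasi-polynomially many in the node count: a POSITIVE answer to Hrubeš–Yehudayoff 2021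
   Open Problem 1 (`σ(DS_n)` super-quasi-polynomial), i.e. the open sibling crux `ShadowBirkhoff` (5069).
   Separated exponents (`d_l = B^l`, `B ≫` all valuations) are useless: digit by digit the optimum moves
   monotonically, `≤ K·m` breakpoints.  Path presentations (ABPs, Hessenberg pencils, the sibling 18500's
   Carstensen–Mulmuley–Shah bump family) are capped by Gusfield's halving bound `N^{O(log N)}`:
   `log₂ Z ≤ O(log²(m²K)) ≤ O((L+c)^{2c})`, which is `o(K log K)` for EVERY `c` — the bump family
   refutes `MatrixDescartesPoly`/`DimensionLaw` and never MDR.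
4. CANCELLATION (theta digits, Hutchinson profiles): a separable magnitude profile is never log-concave
   across carries; pairwise digit interaction = an Ising partition function on `K_n`, and a `2^{polylog}`
   pencil producing it is a quasi-polynomial determinant for the route's own VNP witness — ¬MDR by this
   road is (a case of) `VNP ⊆ VQP`-type collapse, the summit's negation.  Not a cdisprove target.
5. FIXED `m`: `≤ m!·(m(K−1)+1) = O_m(K)` dominance breakpoints and KPT15 Thm 12 (`m = 2`): poly(K).
   Irrelevant to the asymptotics but it explains the lead's table (Z linear in K at m = 2).

6. TROPICAL CALIBRATION (kit job j024062, this seat; `compute/tropassign.py`, exact rationals, hill-climbing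
   lower bounds, 320 s per format on 1 core — an under-achieving optimiser, so read "≥"): maximal number of
   breakpoints found for the K-class parametric assignment `θ ↦ min_σ Σᵢ min_l (v_{iσ(i)l} + θ d_l)`
   (= dominance-forced positive zeros realisable by Viro patchworking in the format `(m, K)`):

       (m,K)   found   Descartes C(m+K−1,K−1)−1   additive m(K−1)
       (2,4)     9          9                        6      (= the real symmetric optimum, §C)
       (2,5)    12         14                        8      (general 2×2 tropical cap 4K−3 = 17)
       (2,6)    14         20                       10      (cap 21)
       (3,3)     9          9                        6      (smoke run)
       (3,4)    16         19                        9
       (3,5)    18         34                       12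
       (4,3)    11         14                        8
       (4,4)    17         34                       12
       (4,5)    22         69                       16
       (5,3)    13         20                       10
       (5,4)    20         55                       15
       (6,3)    17         27                       12
       (6,4)    22         83                       18

   Reading: the optimiser under-achieves — see item 7: `(m,3)` is tropically Descartes-EXTREMAL for every
   `m` by an explicit design, so `11, 13, 17` above are search failures, and the table is a floor only.
7. EXPLICIT TWO-SCALE DESIGN, `K = 3` (this seat, `compute/design3.py`, exact; breakpoints `= C(m+2,2) − 1`
   verified for `m = 2..9`: `5, 9, 14, 20, 27, 35, 44, 54`).  Slopes `(0, 1, D)`, `D` huge.  Class-2 entries on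
   the diagonal, cost `D·g·i` (row `i`), so row `i` is in class 2 exactly while `θ < −g·i`: coarse phases
   `p = m, …, 0` (rows `1..p` in class 2, `m` coarse breakpoints).  Fine entries `(i,j)` with `i+j ≥ m+1`, grouped
   by ANTI-DIAGONALS `i + j = m + p + 1` (one per phase, pairwise disjoint — this is what lets every entry spend
   its single `1 → 0` switch inside its own phase window): class-0 level `λ(i+j)²`, class-1 value `λ(i+j)² − s_{ij}`
   with the `m − p` switch points `s_{ij}` of anti-diagonal `p` spread inside the window of phase `p`.  In phase
   `p` the rows `> p` must be matched inside the block `{p+1..m}²`, where `Σᵢ (i + τ(i))` is the SAME for every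
   bijection `τ`, so by strict convexity of `t ↦ t²` (Jensen) the anti-diagonal matching is the unique optimum
   with margin `2λ ≫` all fine discounts; its entries then switch `1 → 0` one by one: `m − p` fine breakpoints
   per phase, total `m + Σ_p (m−p) = C(m+2,2) − 1`.  Signs alternate at will (each fine switch flips one entry's
   sign; consecutive coarse families differ by the sign of one diagonal entry), so Viro patchworking turns the
   design into REAL `m × m` three-term lacunary pencils with `C(m+2,2) − 1` distinct positive zeros for every `m`
   — an elementary route to the strategist's "(m, 3 terms) Descartes-sharp for all m" (there via Vinnikov), for
   general pencils (symmetric at size `2m` by §B).  Quadratic in `m`: harmless to MDR.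
8. THE DICHOTOMY THIS EXPOSES (rigorous for generic data).  A breakpoint of the tropical count either (a) keeps
   the optimal permutation and changes the class of a matched entry — each of the `m²(K−1)` (entry, transition)
   events happens at ONE `θ`, so there are at most `m²(K−1)` breakpoints of type (a) IN TOTAL (the design of
   item 7 is type (a) plus `m` coarse moves, and the same bookkeeping caps every "fresh-switch" design at
   `≈ m²(K−1)`: Descartes-extremality by this mechanism is impossible from `K = 4` on once `C(m+3,3) > 3m² + m`);
   or (b) changes the permutation while all entry classes are frozen — between two consecutive events the problem
   is a LINEAR parametric assignment whose slope matrix takes `K` values, and type-(b) breakpoints are vertices of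
   a 2-D shadow of the Birkhoff polytope `B_m` along a `K`-valued slope matrix.  Hence
   `Z_trop(m,K) ≤ m²(K−1) + (m²(K−1)+1)·P(m,K)`, `P(m,K)` = max number of optimal permutations of a linear
   parametric assignment with `K` slope values (`P(m,2) = m+1`; hill-climb floor for `P−1`: (3,3) 5, (4,3) 9,
   (5,3) 13, (6,3) 14, (4,4) 10 — `compute/linassign.py`, 25 s each).  In the regime `log m = (L+c)^c` the
   type-(a) budget is `2^{2(L+c)^c}·K ≪ 2^{K·L/q}`, so EVERY tropical MDR-monster is type (b): super-quasi-
   polynomially many optimal permutations from `K ≈ 2^{(log m)^{1/c}}` slope values — Hrubeš–Yehudayoff's Open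
   Problem 1 with a side constraint.  This is the precise form of "tropical ¬MDR ⇒ OP1 answered positively".

So the crux is "summit-or-false" with BOTH directions ≥ named open problems; the informative finite
moves left are (a) the quasi-polynomial cap for K-class parametric assignment (decides whether monsters
can be tropical at all), (b) calibration of `Z_max(m,K)/C(m+K−1,K−1)` for growing `m` at `K = 4,5`.
-/


end Summit.ValiantsHypothesis.ValiantsHypothesis.Cruxes.MatrixDescartes.Disproof
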